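import Literature.NumberTheory.EllipticCurves.IsogenyTwoTorsionProofs
import Literature.NumberTheory.EllipticCurves.IsogenyFrobeniusPointCount
import Literature.NumberTheory.EllipticCurves.MinimalModelReduction
import HarnessLib

/-!
# `2`-isogenous curves over a finite field have equally many points

Sibling file of `Literature.NumberTheory.EllipticCurves.Isogeny` (D-0014 append protocol; everything
here is proved). For Silverman's explicit `2`-isogeny (*AEC*, III.4 Example 4.5; the tree's
`WeierstrassCurve.twoIsogeny`, file `IsogenyTwoTorsionProofs`)
`E₁ : y² = x³ + ax² + bx ⟶ E₂ : Y² = X³ - 2aX² + (a² - 4b)X` over a **finite** field `k` of odd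
characteristic (`E₁` elliptic), we prove `#E₁(k) = #E₂(k)`
(`WeierstrassCurve.natCard_point_eq_natCard_point_twoIsogenyCodomain`) — the instance of
"isogenous curves over a finite field have the same number of points" (Silverman, *AEC*,
Exercise 5.4(a); Tate 1966, Thm. 1(c)) that the tree's computation of the local factors of the CM
curves `j = 54000, 287496, 16581375` needs (Knapp, *Elliptic Curves*, Thm. 11.67, at the primes of
good reduction: "isogenous curves over `𝔽_p` have equally many points").

## Proof

By the prime-degree torsor lemma (`IsogenyFrobeniusPointCount`): `φ = twoIsogeny E₁` is onto on
`k̄`-points (`twoIsogenyFun_surjective`: for `(X, Y) ∈ E₂(k̄)` take a root `x ≠ 0` of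
`x² + (a - X)x + b` and `y = ±√(x(x² + ax + b))`) with kernel `{O, T}` of order `2`
(`degree_twoIsogeny`), so `#E₁(k) ∈ {#E₂(k), 2#E₂(k)}`; the same holds for the `2`-isogeny
`ψ = twoIsogeny E₂ : E₂ → E₃ = ⟨0, 4a, 0, 16b, 0⟩` ("of dual type": `E₃ = ⟨2, 0, 0, 0⟩⁻¹ • E₁`,
i.e. `E₁ ≅ E₃` by `(x, y) ↦ (4x, 8y)`, so `#E₃(k) = #E₁(k)`), and two out of three gives
`#E₁(k) = #E₂(k)`.

## References

* J. H. Silverman, *The Arithmetic of Elliptic Curves*, 2nd ed., GTM 106 (2009), III.4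
  Example 4.5 (p. 70), Exercise 5.4(a) (p. 139). [cite: SilvermanAEC2009]
* A. W. Knapp, *Elliptic Curves*, Math. Notes 40, Princeton 1992, Thm. 11.67 and its sketch of
  proof (PDF pp. 281–282). [cite: Knapp1993]
-/

noncomputable section

open scoped Classical

universe u

namespace WeierstrassCurve

/-! ## Surjectivity of the explicit `2`-isogeny on `k̄`-points -/

section Surjective

open Polynomial

variable {F : Type*} [Field F] [IsAlgClosed F] (V : WeierstrassCurve F) [V.IsTwoTorsionNF]
  [V.IsElliptic]

/-- Over an algebraically closed field, `x² + cx + b` with `b ≠ 0` has a root, necessarily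
non-zero. [folklore] -/
theorem exists_root_quadratic_ne_zero (c : F) {b : F} (hb : b ≠ 0) :
    ∃ x : F, x ≠ 0 ∧ x ^ 2 + c * x + b = 0 := by
  obtain ⟨x, hx⟩ := IsAlgClosed.exists_root (X ^ 2 + C c * X + C b : F[X]) (by
    rw [show (X ^ 2 + C c * X + C b : F[X]).degree = 2 by compute_degree!]; norm_num)
  simp only [IsRoot.def, eval_add, eval_pow, eval_X, eval_mul, eval_C] at hx
  refine ⟨x, fun h0 ↦ hb ?_, hx⟩
  rw [h0] at hx
  simpa using hx

/-- **The explicit `2`-isogeny is onto on points over an algebraically closed field**: for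
`(X, Y) ∈ E₂(F)`, a root `x ≠ 0` of `x² + (a - X)x + b = 0` has `(x² + ax + b)/x = X`, and for
`y = √(x(x² + ax + b))` the point `(x, ±y) ∈ E₁(F)` maps to `(X, ±Y)`. Silverman, *AEC*,
III.4.5 with II.2.3 (non-constant maps of curves are onto). [folklore] -/
theorem twoIsogenyFun_surjective : Function.Surjective V.twoIsogenyFun := by
  rintro (_ | ⟨X, Y, hQ⟩)
  · exact ⟨0, rfl⟩
  obtain ⟨x, hx, hroot⟩ := exists_root_quadratic_ne_zero (V.a₂ - X) (a₄_ne_zero V)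
  have hX : V.twoIsogenyX x = X := by
    rw [twoIsogenyX, div_eq_iff hx]
    linear_combination hroot
  obtain ⟨y, hy⟩ := IsAlgClosed.exists_pow_nat_eq (x ^ 3 + V.a₂ * x ^ 2 + V.a₄ * x) two_pos
  have heq : V.toAffine.Equation x y := (equation_iff_of_isTwoTorsionNF V x y).mpr hy
  have hns : V.toAffine.Nonsingular x y := (Affine.equation_iff_nonsingular).mp heq
  -- the image `(X, s)` lies on `E₂`, as does `(X, Y)`: `s = ± Y`
  have himg := equation_twoIsogeny V heq hx
  rw [hX, equation_iff_of_isTwoTorsionNF] at himg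
  have hQ' := (equation_iff_of_isTwoTorsionNF _ X Y).mp hQ.left
  have hsq : V.twoIsogenyY x y ^ 2 = Y ^ 2 := by rw [himg, hQ']
  rcases sq_eq_sq_iff_eq_or_eq_neg.mp hsq with hs | hs
  · refine ⟨.some x y hns, ?_⟩
    rw [twoIsogenyFun_some V hns hx]
    obtain ⟨h', e⟩ := some_eq_some_of_eq (nonsingular_twoIsogeny V heq hx) hX hs
    rw [e]
  · have hns' : V.toAffine.Nonsingular x (-y) := by
      rw [← negY_of_isTwoTorsionNF V x y]
      exact (Affine.nonsingular_neg x y).mpr hns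
    have hs' : V.twoIsogenyY x (-y) = Y := by
      rw [show V.twoIsogenyY x (-y) = -V.twoIsogenyY x y by simp only [twoIsogenyY]; ring, hs,
        neg_neg]
    refine ⟨.some x (-y) hns', ?_⟩
    rw [twoIsogenyFun_some V hns' hx]
    obtain ⟨h', e⟩ := some_eq_some_of_eq (nonsingular_twoIsogeny V hns'.left hx) hX hs'
    rw [e]

end Surjective

/-! ## The point count -/

section Finite

variable {K : Type u} [Field K] (W : WeierstrassCurve K) [W.IsTwoTorsionNF] [W.IsElliptic]

/-- The `2`-isogeny `twoIsogeny W : E₁ → E₂` is onto on `K̄`-points (it is `twoIsogenyFun` of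
`E₁ ⊗ K̄` followed by a transport). [folklore] -/
theorem twoIsogeny_surjective : Function.Surjective W.twoIsogeny := by
  intro Q
  obtain ⟨P, hP⟩ := twoIsogenyFun_surjective (W.baseChange (AlgebraicClosure K))
    ((Affine.Point.congrEquiv (twoIsogenyCodomain_baseChange W (AlgebraicClosure K))).symm Q)
  refine ⟨P, ?_⟩
  show Affine.Point.congrEquiv _ ((W.baseChange (AlgebraicClosure K)).twoIsogenyFun P) = Q
  rw [hP, AddEquiv.apply_symm_apply]

/-- The kernel of `twoIsogeny W` has `2` elements (`degree_twoIsogeny`). [folklore] -/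
theorem natCard_ker_twoIsogeny : Nat.card (W.twoIsogeny).toAddMonoidHom.ker = 2 :=
  degree_twoIsogeny W

omit [W.IsElliptic] in
/-- `E₁ = ⟨2, 0, 0, 0⟩ • E₃` for `E₃ = ⟨0, 4a, 0, 16b, 0⟩` the codomain of the `2`-isogeny of
`E₂` (the composite `E₁ → E₂ → E₃` is `[2]` followed by `(x, y) ↦ (4x, 8y)`; only the isomorphism
is needed here). Requires `2 ≠ 0`. Silverman, *AEC*, III.4.5 and III.6.1. [folklore] -/
theorem smul_twoIsogenyCodomain_twoIsogenyCodomain (h2 : (2 : K) ≠ 0) :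
    (⟨Units.mk0 2 h2, 0, 0, 0⟩ : VariableChange K) • W.twoIsogenyCodomain.twoIsogenyCodomain = W := by
  ext
  · simp [twoIsogenyCodomain, variableChange_a₁]
  · simp only [variableChange_a₂, twoIsogenyCodomain_a₂, twoIsogenyCodomain_a₁,
      Units.val_inv_eq_inv_val, Units.val_mk0]
    field_simp
    ring
  · simp [twoIsogenyCodomain, variableChange_a₃]
  · simp only [variableChange_a₄, twoIsogenyCodomain_a₄, twoIsogenyCodomain_a₂,
      twoIsogenyCodomain_a₁, twoIsogenyCodomain_a₃, Units.val_inv_eq_inv_val, Units.val_mk0]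
    field_simp
    ring
  · simp [twoIsogenyCodomain, variableChange_a₆]

variable [Finite K]

/-- **`#E₁(k) = #E₂(k)` for the explicit `2`-isogeny over a finite field** `k` (of odd
characteristic, `E₁ : y² = x³ + ax² + bx` elliptic, `E₂ : Y² = X³ - 2aX² + (a² - 4b)X`):
isogenous elliptic curves over a finite field have the same number of rational points (Silverman,
*AEC*, Exercise 5.4(a); the input of Knapp's proof of Thm. 11.67 at the good primes). Proof: the
prime-degree torsor lemma for `φ : E₁ → E₂` and `ψ : E₂ → E₃ ≅ E₁`, two out of three
(`natCard_point_eq_of_isogeny_of_isogeny`).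
[cite: SilvermanAEC2009, Exercise 5.4(a) (p. 139) with III.4 Example 4.5 (p. 70)] -/
theorem natCard_point_eq_natCard_point_twoIsogenyCodomain :
    Nat.card W.toAffine.Point = Nat.card W.twoIsogenyCodomain.toAffine.Point := by
  have h2 : (2 : K) ≠ 0 := two_ne_zero' W
  refine natCard_point_eq_of_isogeny_of_isogeny W.twoIsogeny W.twoIsogenyCodomain.twoIsogeny
    (twoIsogeny_surjective W) (twoIsogeny_surjective _) Nat.prime_two Nat.prime_two
    (natCard_ker_twoIsogeny W) (natCard_ker_twoIsogeny _) ?_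
  conv_rhs => rw [← smul_twoIsogenyCodomain_twoIsogenyCodomain W h2]
  exact (natCard_point_smul _ _).symm

/-- Literal form: for `a, b` in a finite field `k` with `y² = x³ + ax² + bx` elliptic,
`#⟨0, a, 0, b, 0⟩(k) = #⟨0, -2a, 0, a² - 4b, 0⟩(k)`. [cite: SilvermanAEC2009, Exercise 5.4(a)] -/
theorem natCard_point_twoTorsionNF_eq (a b : K) [(⟨0, a, 0, b, 0⟩ : WeierstrassCurve K).IsElliptic] :
    Nat.card (⟨0, a, 0, b, 0⟩ : WeierstrassCurve K).toAffine.Point =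
      Nat.card (⟨0, -2 * a, 0, a ^ 2 - 4 * b, 0⟩ : WeierstrassCurve K).toAffine.Point :=
  natCard_point_eq_natCard_point_twoIsogenyCodomain _

end Finite

end WeierstrassCurve
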